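import Literature.Geometry.DiscreteGeometry.ShellCensusReplaySound
import Mathlib.Analysis.SpecialFunctions.Trigonometric.Basic
import HarnessLib

/-!
# The gapped-shell census of twelve neighbours: patterns, anchors, and `ShellCensus` from a certificate

Topic `Literature/Geometry/DiscreteGeometry`; part 4 of 4 of the replayer for the gapped-shell
census (request `defn-ShellCensusReplay`, crux `ShellCensus` = item `stmt-AtomisticToContinuum-15929`
of route `AtomisticToContinuum/Crystallization/GappedShellCensus`). The instance and the entry
points:

* `gappedTwelve : Spec` — twelve points, norms and bonds in `[49/50, 51/50]`, far pairs
  `≥ 63/50`, closeness `1/5`, anchor accuracy `10⁻⁶` — and `gappedTwelvePatterns`: the exact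
  patterns `fccTuple` (cuboctahedron, `= fccKissingPattern` as a set, `image_fccTuple`),
  `hcpTuple` (anticuboctahedron, `image_hcpTuple`) and `decTuple` (**`decahedralKissingPattern`**,
  the bicapped pentagonal prism: poles `(0, 0, ±1)`, two aligned pentagons of circumradius `√3/2`
  at heights `±1/2`, spelled exactly as inlined in the route statements, `image_decTuple`), with
  rational anchors and the accuracy proofs (`√2`, `√3`, `√5`, `√18` to ten digits;
  `cos (2πk/5)`, `sin (2πk/5)` through `Real.cos_pi_div_five`; `pentagon_trig_bounds`);
* **`shellCensus_of_claim`**, **`shellCensus_of_check`**, **`shellCensus_of_text`**: the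
  unconditional claim of `gappedTwelve` — in particular an ACCEPTED CENSUS CERTIFICATE, as a term
  or as text — implies, literally, the statement `ShellCensus` of the route (every twelve-point
  set with norms in `[1 − 1/50, 1 + 1/50]` and pairwise distances in
  `[1 − 1/50, 1 + 1/50] ∪ [63/50, ∞)` is `ShellCloseTo (1/5)` the fcc, hcp or decahedral pattern).
  Intended use by the prover of that item, once the lane's certificate `cert : String` exists:
  `theorem … : ShellCensus := shellCensus_of_text cert (by native_decide)` (a `computational`
  proposal), or in several files via `Census.claims_append_of_checkFrom` and
  `shellCensus_of_claim (Spec.claim_nil_of_claims …)`;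
* `admissible_fccTuple`: the hypotheses of the census are consistent (the fcc pattern with unit
  bonds is admissible: norms `1`, distances `1` or `≥ √2 > 63/50`);
* a toy specification and census (`toySpec`, `toyCensus`) exercising every rule, accepted by
  kernel evaluation (`decide +kernel`) — the smoke test of the checker.

Nothing here asserts that a certificate EXISTS: `ShellCensus` itself stays the route's crux.

## References
* J. P. K. Doye, *Physical perspectives on the global optimization of atomic clusters* (2000),
  §2 — decahedral particles: five strained tetrahedra about a common edge; the atom on the
  five-fold axis has the bicapped-pentagonal-prism shell (cf. the barrier
  `Literature.Barriers.AtomisticToContinuum.DecahedralSoftShell`). [cite: Doye2000, §2 (arXiv p. 5)]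
* T. C. Hales, *Dense Sphere Packings* (2012), §1.3 (FCC and HCP patterns). [cite: HalesDSP2012, §1.3]
* R. E. Moore, *Interval Analysis* (1966), Theorem 3.1, §4.4. [cite: Moore1966, Theorem 3.1, §4.4]
-/

noncomputable section

namespace Literature.Geometry.DiscreteGeometry

open Literature.Analysis.ValidatedNumerics NonemptyInterval Finset

/-- Euclidean `3`-space. -/
local notation "E3" => EuclideanSpace ℝ (Fin 3)

namespace ShellCensus

/-! ### Numerical constants -/

/-- `√5 ∈ [2.236067977, 2.236067978]`. [folklore] -/
theorem sqrt_five_bounds :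
    (2236067977 / 10 ^ 9 : ℝ) ≤ Real.sqrt 5 ∧ Real.sqrt 5 ≤ 2236067978 / 10 ^ 9 := by
  constructor
  · rw [Real.le_sqrt (by norm_num) (by norm_num)]; norm_num
  · rw [Real.sqrt_le_left (by norm_num)]; norm_num

/-- `√3 ∈ [1.7320508075, 1.7320508076]`. [folklore] -/
theorem sqrt_three_bounds :
    (17320508075 / 10 ^ 10 : ℝ) ≤ Real.sqrt 3 ∧ Real.sqrt 3 ≤ 17320508076 / 10 ^ 10 := by
  constructor
  · rw [Real.le_sqrt (by norm_num) (by norm_num)]; norm_num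
  · rw [Real.sqrt_le_left (by norm_num)]; norm_num

/-- `√2 ∈ [1.4142135623, 1.4142135624]`. [folklore] -/
theorem sqrt_two_bounds :
    (14142135623 / 10 ^ 10 : ℝ) ≤ Real.sqrt 2 ∧ Real.sqrt 2 ≤ 14142135624 / 10 ^ 10 := by
  constructor
  · rw [Real.le_sqrt (by norm_num) (by norm_num)]; norm_num
  · rw [Real.sqrt_le_left (by norm_num)]; norm_num

/-- `√18 ∈ [4.242640687, 4.242640688]`. [folklore] -/
theorem sqrt_eighteen_bounds :
    (4242640687 / 10 ^ 9 : ℝ) ≤ Real.sqrt 18 ∧ Real.sqrt 18 ≤ 4242640688 / 10 ^ 9 := by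
  constructor
  · rw [Real.le_sqrt (by norm_num) (by norm_num)]; norm_num
  · rw [Real.sqrt_le_left (by norm_num)]; norm_num

/-- `cos (2π/5) = (√5 − 1)/4`. [folklore] -/
theorem cos_two_pi_div_five : Real.cos (2 * (Real.pi / 5)) = (Real.sqrt 5 - 1) / 4 := by
  rw [Real.cos_two_mul, Real.cos_pi_div_five]
  have h5 : Real.sqrt 5 ^ 2 = 5 := Real.sq_sqrt (by norm_num)
  nlinarith [h5]

/-- `sin (2π/5)² = (10 + 2√5)/16` and `sin (2π/5) > 0`. [folklore] -/
theorem sin_two_pi_div_five :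
    Real.sin (2 * (Real.pi / 5)) ^ 2 = (10 + 2 * Real.sqrt 5) / 16 ∧ 0 < Real.sin (2 * (Real.pi / 5)) := by
  refine ⟨?_, Real.sin_pos_of_pos_of_lt_pi (by positivity) (by linarith [Real.pi_pos])⟩
  have h := Real.sin_sq_add_cos_sq (2 * (Real.pi / 5))
  rw [cos_two_pi_div_five] at h
  have h5 : Real.sqrt 5 ^ 2 = 5 := Real.sq_sqrt (by norm_num)
  nlinarith [h5]

/-- `sin (π/5)² = (10 − 2√5)/16` and `sin (π/5) > 0`. [folklore] -/
theorem sin_pi_div_five :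
    Real.sin (Real.pi / 5) ^ 2 = (10 - 2 * Real.sqrt 5) / 16 ∧ 0 < Real.sin (Real.pi / 5) := by
  refine ⟨?_, Real.sin_pos_of_pos_of_lt_pi (by positivity) (by linarith [Real.pi_pos])⟩
  have h := Real.sin_sq_add_cos_sq (Real.pi / 5)
  rw [Real.cos_pi_div_five] at h
  have h5 : Real.sqrt 5 ^ 2 = 5 := Real.sq_sqrt (by norm_num)
  nlinarith [h5]

/-- From bounds on the square to bounds on a nonnegative real. [folklore] -/
theorem abs_sub_le_of_sq_bounds {s a δ : ℝ} (lo hi : ℝ) (hs : 0 ≤ s) (hlo : lo ≤ s ^ 2)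
    (hhi : s ^ 2 ≤ hi) (hδ : 0 ≤ δ) (ha : δ ≤ a) (h1 : hi ≤ (a + δ) ^ 2) (h2 : (a - δ) ^ 2 ≤ lo) :
    |s - a| ≤ δ := by
  rw [abs_le]
  constructor
  · have : a - δ ≤ s := (sq_le_sq₀ (by linarith) hs).1 (by linarith)
    linarith
  · have : s ≤ a + δ := (sq_le_sq₀ hs (by linarith)).1 (by linarith)
    linarith

/-- `|−x − (−q)| = |x − q|`. [folklore] -/
theorem abs_neg_sub_neg' (x q : ℝ) : |-x - -q| = |x - q| := by
  rw [← abs_neg]; ring_nf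

/-- Rational approximations of `cos (2πk/5)`, `k = 0, …, 4`. [folklore] -/
def cosTab (k : ℕ) : ℚ :=
  if k = 0 then 1 else if k = 1 ∨ k = 4 then 3090169944 / 10 ^ 10 else -8090169944 / 10 ^ 10

/-- Rational approximations of `sin (2πk/5)`, `k = 0, …, 4`. [folklore] -/
def sinTab (k : ℕ) : ℚ :=
  if k = 0 then 0 else if k = 1 then 9510565163 / 10 ^ 10 else if k = 2 then 5877852523 / 10 ^ 10
  else if k = 3 then -5877852523 / 10 ^ 10 else -9510565163 / 10 ^ 10

/-- **The pentagon angles to within `10⁻⁷`.** [folklore] -/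
theorem pentagon_trig_bounds (k : ℕ) (hk : k < 5) :
    |Real.cos (2 * Real.pi * k / 5) - cosTab k| ≤ 1 / 10 ^ 7 ∧
      |Real.sin (2 * Real.pi * k / 5) - sinTab k| ≤ 1 / 10 ^ 7 := by
  obtain ⟨h5lo, h5hi⟩ := sqrt_five_bounds
  have hc1 := cos_two_pi_div_five
  obtain ⟨hs1, hs1pos⟩ := sin_two_pi_div_five
  obtain ⟨hs2, hs2pos⟩ := sin_pi_div_five
  have hcosA : |(Real.sqrt 5 - 1) / 4 - (3090169944 / 10 ^ 10 : ℝ)| ≤ 1 / 10 ^ 7 := by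
    rw [abs_le]; constructor <;> linarith
  have hcosB : |-((1 + Real.sqrt 5) / 4) - (-8090169944 / 10 ^ 10 : ℝ)| ≤ 1 / 10 ^ 7 := by
    rw [abs_le]; constructor <;> linarith
  have hsinA : |Real.sin (2 * (Real.pi / 5)) - (9510565163 / 10 ^ 10 : ℝ)| ≤ 1 / 10 ^ 7 := by
    refine abs_sub_le_of_sq_bounds ((10 + 2 * (2236067977 / 10 ^ 9 : ℝ)) / 16)
      ((10 + 2 * (2236067978 / 10 ^ 9 : ℝ)) / 16) hs1pos.le (by rw [hs1]; linarith)
      (by rw [hs1]; linarith) (by norm_num) (by norm_num) ?_ ?_ <;> norm_num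
  have hsinB : |Real.sin (Real.pi / 5) - (5877852523 / 10 ^ 10 : ℝ)| ≤ 1 / 10 ^ 7 := by
    refine abs_sub_le_of_sq_bounds ((10 - 2 * (2236067978 / 10 ^ 9 : ℝ)) / 16)
      ((10 - 2 * (2236067977 / 10 ^ 9 : ℝ)) / 16) hs2pos.le (by rw [hs2]; linarith)
      (by rw [hs2]; linarith) (by norm_num) (by norm_num) ?_ ?_ <;> norm_num
  interval_cases k
  · simp [cosTab, sinTab]
  · have e : 2 * Real.pi * ((1 : ℕ) : ℝ) / 5 = 2 * (Real.pi / 5) := by push_cast; ring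
    rw [e, hc1]
    constructor
    · simpa [cosTab] using hcosA
    · simpa [sinTab] using hsinA
  · have e : 2 * Real.pi * ((2 : ℕ) : ℝ) / 5 = Real.pi - Real.pi / 5 := by push_cast; ring
    rw [e, Real.cos_pi_sub, Real.sin_pi_sub, Real.cos_pi_div_five]
    constructor
    · simpa [cosTab] using hcosB
    · simpa [sinTab] using hsinB
  · have e : 2 * Real.pi * ((3 : ℕ) : ℝ) / 5 = Real.pi / 5 + Real.pi := by push_cast; ring
    rw [e, Real.cos_add_pi, Real.sin_add_pi, Real.cos_pi_div_five]
    constructor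
    · simpa [cosTab] using hcosB
    · have : ((sinTab 3 : ℚ) : ℝ) = -(5877852523 / 10 ^ 10 : ℝ) := by norm_num [sinTab]
      rw [this, abs_neg_sub_neg']
      exact hsinB
  · have e : 2 * Real.pi * ((4 : ℕ) : ℝ) / 5 = 2 * Real.pi - 2 * (Real.pi / 5) := by push_cast; ring
    rw [e, Real.cos_two_pi_sub, Real.sin_two_pi_sub, hc1]
    constructor
    · simpa [cosTab] using hcosA
    · have : ((sinTab 4 : ℚ) : ℝ) = -(9510565163 / 10 ^ 10 : ℝ) := by norm_num [sinTab]
      rw [this, abs_neg_sub_neg']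
      exact hsinA

/-! ### Coordinatewise distance bounds -/

/-- If every coordinate differs by at most `m ≥ 0` then the distance is at most `2m`. [folklore] -/
theorem dist_le_two_mul_of_coord {x y : E3} {m : ℝ} (hm : 0 ≤ m) (h : ∀ i, |x i - y i| ≤ m) :
    dist x y ≤ 2 * m := by
  have hsq : dist x y ^ 2 ≤ (2 * m) ^ 2 := by
    rw [dist_sq_fin3]
    have h0 := sq_le_sq' (abs_le.1 (h 0)).1 (abs_le.1 (h 0)).2
    have h1 := sq_le_sq' (abs_le.1 (h 1)).1 (abs_le.1 (h 1)).2
    have h2 := sq_le_sq' (abs_le.1 (h 2)).1 (abs_le.1 (h 2)).2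
    nlinarith
  exact (sq_le_sq₀ dist_nonneg (by linarith)).1 hsq

/-- `|h c − h' c'| ≤ δ₁ + δ₂` when `|h − h'| ≤ δ₁`, `|c − c'| ≤ δ₂`, `|c| ≤ 1`, `|h'| ≤ 1`. [folklore] -/
theorem abs_mul_sub_mul_le {h h' c c' δ₁ δ₂ : ℝ} (hh : |h - h'| ≤ δ₁) (hc : |c - c'| ≤ δ₂)
    (hc1 : |c| ≤ 1) (hh1 : |h'| ≤ 1) : |h * c - h' * c'| ≤ δ₁ + δ₂ := by
  have e : h * c - h' * c' = (h - h') * c + h' * (c - c') := by ring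
  rw [e]
  refine (abs_add_le _ _).trans ?_
  rw [abs_mul, abs_mul]
  have hδ₁ : 0 ≤ δ₁ := (abs_nonneg _).trans hh
  have hδ₂ : 0 ≤ δ₂ := (abs_nonneg _).trans hc
  nlinarith [abs_nonneg (h - h'), abs_nonneg c, abs_nonneg h', abs_nonneg (c - c'),
    mul_le_mul hh hc1 (abs_nonneg c) hδ₁, mul_le_mul hh1 hc (abs_nonneg _) zero_le_one]

/-! ### The three patterns as tuples, with rational anchors -/

/-- The fcc pattern's integer vectors in a fixed order. [cite: ConwaySloane1999, Ch. 4 §6.3] -/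
def fccVec : Fin 12 → (Fin 3 → ℤ) :=
  ![![1, 1, 0], ![1, -1, 0], ![-1, 1, 0], ![-1, -1, 0],
    ![1, 0, 1], ![1, 0, -1], ![-1, 0, 1], ![-1, 0, -1],
    ![0, 1, 1], ![0, 1, -1], ![0, -1, 1], ![0, -1, -1]]

/-- The hcp pattern's integer vectors (scale `3`) in a fixed order. [cite: HalesDSP2012, §1.3, Fig. 1.11] -/
def hcpVec : Fin 12 → (Fin 3 → ℤ) :=
  ![![3, -3, 0], ![-3, 3, 0], ![3, 0, -3], ![-3, 0, 3], ![0, 3, -3], ![0, -3, 3],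
    ![3, 3, 0], ![3, 0, 3], ![0, 3, 3],
    ![-1, -1, -4], ![-1, -4, -1], ![-4, -1, -1]]

/-- `fccVec` enumerates `fccInt`. [folklore] -/
theorem image_fccVec : univ.image fccVec = fccInt := by decide

/-- `hcpVec` enumerates `hcpInt`. [folklore] -/
theorem image_hcpVec : univ.image hcpVec = hcpInt := by decide

/-- The fcc pattern as a tuple. [cite: HalesDSP2012, §1.3] -/
noncomputable def fccTuple (k : Fin 12) : E3 := (Real.sqrt (2 : ℕ))⁻¹ • intVec (fccVec k)

/-- The hcp pattern as a tuple. [cite: HalesDSP2012, §1.3] -/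
noncomputable def hcpTuple (k : Fin 12) : E3 := (Real.sqrt (18 : ℕ))⁻¹ • intVec (hcpVec k)

/-- `fccTuple` enumerates `fccKissingPattern`. [folklore] -/
theorem image_fccTuple : univ.image fccTuple = fccKissingPattern := by
  rw [fccKissingPattern, scaledPattern, ← image_fccVec, Finset.image_image]
  rfl

/-- `hcpTuple` enumerates `hcpKissingPattern`. [folklore] -/
theorem image_hcpTuple : univ.image hcpTuple = hcpKissingPattern := by
  rw [hcpKissingPattern, scaledPattern, ← image_hcpVec, Finset.image_image]
  rfl

/-- `fccTuple` is injective. [folklore] -/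
theorem fccTuple_injective : Function.Injective fccTuple :=
  (scaledPattern_map_injective two_ne_zero).comp (by decide : Function.Injective fccVec)

/-- `hcpTuple` is injective. [folklore] -/
theorem hcpTuple_injective : Function.Injective hcpTuple :=
  (scaledPattern_map_injective (by norm_num)).comp (by decide : Function.Injective hcpVec)

/-- **The decahedral-axis kissing pattern** (bicapped pentagonal prism): poles `(0,0,±1)` and
two aligned regular pentagons of circumradius `√3/2` at heights `±1/2` — the twelve neighbours
of an atom on the five-fold axis of a decahedral / icosahedral cluster (Ino's decahedron); all
twelve are unit vectors, the ten pole–pentagon and five prism edges have length `1`, the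
pentagon edges `√3/2 · 2 sin 36° ≈ 1.018`. Spelled exactly as inlined in the statements of route
`GappedShellCensus`. [cite: Doye2000, §2 (arXiv p. 5)] -/
noncomputable def decahedralKissingPattern : Finset E3 :=
  ((Finset.univ.image fun k : Fin 5 => !₂[Real.sqrt 3 / 2 * Real.cos (2 * Real.pi * k / 5),
      Real.sqrt 3 / 2 * Real.sin (2 * Real.pi * k / 5), (1 : ℝ) / 2]) ∪
    (Finset.univ.image fun k : Fin 5 => !₂[Real.sqrt 3 / 2 * Real.cos (2 * Real.pi * k / 5),
      Real.sqrt 3 / 2 * Real.sin (2 * Real.pi * k / 5), -(1 : ℝ) / 2]) ∪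
    {!₂[(0 : ℝ), 0, 1], !₂[(0 : ℝ), 0, -1]})

/-- Point `k` of the decahedral pattern: `k < 5` upper pentagon, `5 ≤ k < 10` lower pentagon,
`10, 11` the poles. [folklore] -/
noncomputable def decPt (k : ℕ) : E3 :=
  if k < 5 then !₂[Real.sqrt 3 / 2 * Real.cos (2 * Real.pi * k / 5),
      Real.sqrt 3 / 2 * Real.sin (2 * Real.pi * k / 5), (1 : ℝ) / 2]
  else if k < 10 then !₂[Real.sqrt 3 / 2 * Real.cos (2 * Real.pi * (k - 5 : ℕ) / 5),
      Real.sqrt 3 / 2 * Real.sin (2 * Real.pi * (k - 5 : ℕ) / 5), -(1 : ℝ) / 2]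
  else if k = 10 then !₂[(0 : ℝ), 0, 1] else !₂[(0 : ℝ), 0, -1]

/-- The decahedral pattern as a tuple. [folklore] -/
noncomputable def decTuple (k : Fin 12) : E3 := decPt k

/-- `decTuple` enumerates `decahedralKissingPattern`. [folklore] -/
theorem image_decTuple : univ.image decTuple = decahedralKissingPattern := by
  apply Finset.Subset.antisymm
  · rw [Finset.image_subset_iff]
    intro k _
    simp only [decahedralKissingPattern, Finset.mem_union, Finset.mem_image, Finset.mem_univ,
      true_and, Finset.mem_insert, Finset.mem_singleton, decTuple, decPt]
    by_cases h1 : (k : ℕ) < 5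
    · exact Or.inl (Or.inl ⟨⟨k, h1⟩, by rw [if_pos h1]⟩)
    by_cases h2 : (k : ℕ) < 10
    · exact Or.inl (Or.inr ⟨⟨k - 5, by omega⟩, by rw [if_neg h1, if_pos h2]⟩)
    by_cases h3 : (k : ℕ) = 10
    · exact Or.inr (Or.inl (by rw [if_neg h1, if_neg h2, if_pos h3]))
    · exact Or.inr (Or.inr (by rw [if_neg h1, if_neg h2, if_neg h3]))
  · intro x hx
    simp only [decahedralKissingPattern, Finset.mem_union, Finset.mem_image, Finset.mem_univ,
      true_and, Finset.mem_insert, Finset.mem_singleton] at hx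
    simp only [Finset.mem_image, Finset.mem_univ, true_and, decTuple, decPt]
    rcases hx with (⟨k, rfl⟩ | ⟨k, rfl⟩) | rfl | rfl
    · exact ⟨⟨k, by omega⟩, by rw [if_pos (by simp)]⟩
    · refine ⟨⟨k + 5, by omega⟩, ?_⟩
      rw [if_neg (by simp), if_pos (by simp; omega)]
      simp
    · exact ⟨⟨10, by omega⟩, by simp⟩
    · exact ⟨⟨11, by omega⟩, by simp⟩

/-- Scaling an integer vector by a rational. [folklore] -/
def scaleAnchor (a : ℚ) (v : Fin 3 → ℤ) : ℚ × ℚ × ℚ := (a * v 0, a * v 1, a * v 2)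

/-- Anchors of the fcc pattern: `0.70710678 · fccVec`. [folklore] -/
def fccAnchors : List (ℚ × ℚ × ℚ) :=
  (List.finRange 12).map fun k => scaleAnchor (70710678 / 10 ^ 8) (fccVec k)

/-- Anchors of the hcp pattern: `0.2357022604 · hcpVec`. [folklore] -/
def hcpAnchors : List (ℚ × ℚ × ℚ) :=
  (List.finRange 12).map fun k => scaleAnchor (2357022604 / 10 ^ 10) (hcpVec k)

/-- Anchor `k` of the decahedral pattern (`0.8660254038 ≈ √3/2` times the angle tables). [folklore] -/
def decAnchor (k : ℕ) : ℚ × ℚ × ℚ :=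
  if k < 5 then (8660254038 / 10 ^ 10 * cosTab k, 8660254038 / 10 ^ 10 * sinTab k, 1 / 2)
  else if k < 10 then
    (8660254038 / 10 ^ 10 * cosTab (k - 5), 8660254038 / 10 ^ 10 * sinTab (k - 5), -1 / 2)
  else if k = 10 then (0, 0, 1) else (0, 0, -1)

/-- Anchors of the decahedral pattern. [folklore] -/
def decAnchors : List (ℚ × ℚ × ℚ) := (List.range 12).map decAnchor

/-- **The census specification of route `GappedShellCensus`**: twelve points, norms and bonds
in `[49/50, 51/50]`, far pairs `≥ 63/50`, closeness `1/5`, anchors accurate to `10⁻⁶`. [folklore] -/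
def gappedTwelve : Spec where
  n := 12
  rlo := 49 / 50
  rhi := 51 / 50
  dlo := 49 / 50
  dhi := 51 / 50
  gap := 63 / 50
  eta := 1 / 5
  eps := 1 / 10 ^ 6
  anchors := [fccAnchors, hcpAnchors, decAnchors]

/-- The anchors of `gappedTwelve`, unfolded. [folklore] -/
theorem gappedTwelve_anchor (i : ℕ) (k : Fin 12) :
    gappedTwelve.anchor i k =
      if i = 0 then scaleAnchor (70710678 / 10 ^ 8) (fccVec k)
      else if i = 1 then scaleAnchor (2357022604 / 10 ^ 10) (hcpVec k)
      else if i = 2 then decAnchor k else (0, 0, 0) := by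
  unfold Spec.anchor gappedTwelve
  rcases i with _ | _ | _ | i
  · simp [fccAnchors, List.getElem_finRange]; rfl
  · simp [hcpAnchors, List.getElem_finRange]; rfl
  · simp [decAnchors]
  · simp

/-- A scaled integer vector with `|vᵢ| ≤ 4` is within `10⁻⁶` of its anchor when the scale is
within `10⁻⁷` of the rational. [folklore] -/
theorem dist_smul_intVec_anchor {c : ℝ} {a : ℚ} (v : Fin 3 → ℤ) (hca : |c - a| ≤ 1 / 10 ^ 7)
    (hv : ∀ i, |(v i : ℝ)| ≤ 4) : dist (c • intVec v) (qpt (scaleAnchor a v)) ≤ 1 / 10 ^ 6 := by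
  have hm : ∀ i : Fin 3, |(c • intVec v) i - qpt (scaleAnchor a v) i| ≤ 5 / 10 ^ 7 := by
    intro i
    have e : (c • intVec v) i - qpt (scaleAnchor a v) i = (c - a) * v i := by
      fin_cases i <;> simp [scaleAnchor, intVec] <;> ring
    rw [e, abs_mul]
    nlinarith [abs_nonneg (c - a), abs_nonneg ((v i : ℝ)), hv i]
  linarith [dist_le_two_mul_of_coord (by norm_num) hm]

/-- `(√2)⁻¹` to within `10⁻⁷`. [folklore] -/
theorem abs_inv_sqrt_two_sub_le : |(Real.sqrt (2 : ℕ))⁻¹ - ((70710678 / 10 ^ 8 : ℚ) : ℝ)| ≤ 1 / 10 ^ 7 := by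
  obtain ⟨hlo, hhi⟩ := sqrt_two_bounds
  have hpos : 0 < Real.sqrt 2 := by positivity
  have e : (Real.sqrt (2 : ℕ))⁻¹ = Real.sqrt 2 / 2 := by
    rw [Nat.cast_ofNat, eq_div_iff two_ne_zero, ← Real.sqrt_mul_self zero_le_two,
      Real.sqrt_mul_self zero_le_two]
    field_simp
    rw [Real.sq_sqrt zero_le_two]
  rw [e, abs_le]; push_cast; constructor <;> linarith

/-- `(√18)⁻¹` to within `10⁻⁷`. [folklore] -/
theorem abs_inv_sqrt_eighteen_sub_le :
    |(Real.sqrt (18 : ℕ))⁻¹ - ((2357022604 / 10 ^ 10 : ℚ) : ℝ)| ≤ 1 / 10 ^ 7 := by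
  obtain ⟨hlo, hhi⟩ := sqrt_eighteen_bounds
  have h18 : (0 : ℝ) ≤ 18 := by norm_num
  have e : (Real.sqrt (18 : ℕ))⁻¹ = Real.sqrt 18 / 18 := by
    rw [Nat.cast_ofNat, eq_div_iff (by norm_num)]
    field_simp
    rw [Real.sq_sqrt h18]
  rw [e, abs_le]; push_cast; constructor <;> linarith

/-- `√3/2` to within `10⁻⁷`. [folklore] -/
theorem abs_sqrt_three_div_two_sub_le :
    |Real.sqrt 3 / 2 - ((8660254038 / 10 ^ 10 : ℚ) : ℝ)| ≤ 1 / 10 ^ 7 := by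
  obtain ⟨hlo, hhi⟩ := sqrt_three_bounds
  rw [abs_le]; push_cast; constructor <;> linarith

/-- The fcc tuple is within `10⁻⁶` of its anchors. [folklore] -/
theorem dist_fccTuple_anchor (k : Fin 12) :
    dist (fccTuple k) (qpt (scaleAnchor (70710678 / 10 ^ 8) (fccVec k))) ≤ 1 / 10 ^ 6 :=
  dist_smul_intVec_anchor _ abs_inv_sqrt_two_sub_le (by
    have h : ∀ k : Fin 12, ∀ i : Fin 3, |fccVec k i| ≤ 4 := by decide
    intro i; exact_mod_cast h k i)

/-- The hcp tuple is within `10⁻⁶` of its anchors. [folklore] -/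
theorem dist_hcpTuple_anchor (k : Fin 12) :
    dist (hcpTuple k) (qpt (scaleAnchor (2357022604 / 10 ^ 10) (hcpVec k))) ≤ 1 / 10 ^ 6 :=
  dist_smul_intVec_anchor _ abs_inv_sqrt_eighteen_sub_le (by
    have h : ∀ k : Fin 12, ∀ i : Fin 3, |hcpVec k i| ≤ 4 := by decide
    intro i; exact_mod_cast h k i)

/-- A pentagon point is within `10⁻⁶` of its anchor. [folklore] -/
theorem dist_pentagon_anchor (k : ℕ) (hk : k < 5) (z : ℝ) (zq : ℚ) (hz : z = zq) :
    dist (!₂[Real.sqrt 3 / 2 * Real.cos (2 * Real.pi * k / 5),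
        Real.sqrt 3 / 2 * Real.sin (2 * Real.pi * k / 5), z] : E3)
      (qpt (8660254038 / 10 ^ 10 * cosTab k, 8660254038 / 10 ^ 10 * sinTab k, zq)) ≤ 1 / 10 ^ 6 := by
  obtain ⟨hc, hs⟩ := pentagon_trig_bounds k hk
  have hh := abs_sqrt_three_div_two_sub_le
  have hh1 : |((8660254038 / 10 ^ 10 : ℚ) : ℝ)| ≤ 1 := by rw [abs_le]; push_cast; constructor <;> norm_num
  have hm : ∀ i : Fin 3, |(!₂[Real.sqrt 3 / 2 * Real.cos (2 * Real.pi * k / 5),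
      Real.sqrt 3 / 2 * Real.sin (2 * Real.pi * k / 5), z] : E3) i -
      qpt (8660254038 / 10 ^ 10 * cosTab k, 8660254038 / 10 ^ 10 * sinTab k, zq) i| ≤ 5 / 10 ^ 7 := by
    intro i
    fin_cases i
    · simp only [Fin.zero_eta, Fin.isValue, Matrix.cons_val_zero, qpt_apply_zero, Rat.cast_mul]
      linarith [abs_mul_sub_mul_le hh hc (Real.abs_cos_le_one _) hh1]
    · simp only [Fin.mk_one, Fin.isValue, Matrix.cons_val_one, Matrix.cons_val_zero,
        qpt_apply_one, Rat.cast_mul]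
      linarith [abs_mul_sub_mul_le hh hs (Real.abs_sin_le_one _) hh1]
    · simp only [Fin.reduceFinMk, Fin.isValue, qpt_apply_two]
      norm_num [hz, Matrix.cons_val_two, Matrix.tail_cons, Matrix.head_cons]
  linarith [dist_le_two_mul_of_coord (by norm_num) hm]

/-- The decahedral tuple is within `10⁻⁶` of its anchors. [folklore] -/
theorem dist_decTuple_anchor (k : Fin 12) : dist (decTuple k) (qpt (decAnchor k)) ≤ 1 / 10 ^ 6 := by
  simp only [decTuple, decPt, decAnchor]
  by_cases h1 : (k : ℕ) < 5
  · rw [if_pos h1, if_pos h1]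
    exact dist_pentagon_anchor k h1 _ _ (by norm_num)
  by_cases h2 : (k : ℕ) < 10
  · rw [if_neg h1, if_pos h2, if_neg h1, if_pos h2]
    exact dist_pentagon_anchor (k - 5) (by omega) _ _ (by norm_num)
  by_cases h3 : (k : ℕ) = 10
  · rw [if_neg h1, if_neg h2, if_pos h3, if_neg h1, if_neg h2, if_pos h3]
    simp [qpt]
  · rw [if_neg h1, if_neg h2, if_neg h3, if_neg h1, if_neg h2, if_neg h3]
    simp [qpt]

/-- **The patterns of `gappedTwelve`**: fcc, hcp, decahedral axis. [folklore] -/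
noncomputable def gappedTwelvePatterns : gappedTwelve.Patterns where
  pts := [fccTuple, hcpTuple, decTuple]
  len_eq := rfl
  close i hi k := by
    have hi3 : i < 3 := hi
    rw [gappedTwelve_anchor]
    have heps : ((gappedTwelve.eps : ℚ) : ℝ) = 1 / 10 ^ 6 := by norm_num [gappedTwelve]
    rw [heps]
    interval_cases i
    · simpa using dist_fccTuple_anchor k
    · simpa using dist_hcpTuple_anchor k
    · simpa using dist_decTuple_anchor k

/-! ### Separation and injectivity of the decahedral pattern -/

/-- The anchors of `gappedTwelve` are well separated (kernel computation). [folklore] -/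
theorem gappedTwelve_anchorsSep :
    gappedTwelve.anchorsSepB 0 = true ∧ gappedTwelve.anchorsSepB 1 = true ∧
      gappedTwelve.anchorsSepB 2 = true := by
  decide +kernel

/-- `decTuple` is injective. [folklore] -/
theorem decTuple_injective : Function.Injective decTuple :=
  gappedTwelvePatterns.injective_of_sep (i := 2) (by decide) gappedTwelve_anchorsSep.2.2

/-- The data of `gappedTwelve` pass the sign/shape test. [folklore] -/
theorem gappedTwelve_okB : gappedTwelve.okB = true := by decide +kernel

/-! ### The soundness theorem in the form of the route statement -/

/-- **The unconditional claim of `gappedTwelve` is `ShellCensus`.** If every admissible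
twelve-tuple is good (the conclusion of an accepted census, `Census.check_sound`, or of a
census split over several files, `Census.claims_append_of_checkFrom` + `Spec.claim_nil_of_claims`),
then every twelve-point set in `ℝ³` with norms in `[1 − 1/50, 1 + 1/50]` and pairwise distances
in `[1 − 1/50, 1 + 1/50] ∪ [63/50, ∞)` is `1/5`-close, after a linear isometry, to the fcc, the
hcp or the decahedral-axis pattern — literally the statement `ShellCensus` of route
`AtomisticToContinuum/Crystallization/GappedShellCensus`. [folklore] -/
theorem shellCensus_of_claim (hclaim : gappedTwelve.Claim gappedTwelvePatterns []) :
    ∀ T : Finset (EuclideanSpace ℝ (Fin 3)), T.card = 12 →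
      (∀ v ∈ T, 1 - 1 / 50 ≤ ‖v‖ ∧ ‖v‖ ≤ 1 + 1 / 50) →
      (∀ v ∈ T, ∀ w ∈ T, v ≠ w → 1 - 1 / 50 ≤ dist v w ∧ (dist v w ≤ 1 + 1 / 50 ∨ 63 / 50 ≤ dist v w)) →
      Literature.Geometry.DiscreteGeometry.ShellCloseTo (1 / 5) T
          Literature.Geometry.DiscreteGeometry.fccKissingPattern ∨
        Literature.Geometry.DiscreteGeometry.ShellCloseTo (1 / 5) T
          Literature.Geometry.DiscreteGeometry.hcpKissingPattern ∨
        Literature.Geometry.DiscreteGeometry.ShellCloseTo (1 / 5) T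
          ((Finset.univ.image fun k : Fin 5 => !₂[Real.sqrt 3 / 2 * Real.cos (2 * Real.pi * k / 5),
              Real.sqrt 3 / 2 * Real.sin (2 * Real.pi * k / 5), (1 : ℝ) / 2]) ∪
            (Finset.univ.image fun k : Fin 5 => !₂[Real.sqrt 3 / 2 * Real.cos (2 * Real.pi * k / 5),
              Real.sqrt 3 / 2 * Real.sin (2 * Real.pi * k / 5), -(1 : ℝ) / 2]) ∪
            {!₂[(0 : ℝ), 0, 1], !₂[(0 : ℝ), 0, -1]}) := by
  intro T hT hnorm hdist
  obtain ⟨t, ht, rfl⟩ := exists_tuple_of_card T hT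
  have hmem : ∀ k, t k ∈ univ.image t := fun k => Finset.mem_image_of_mem t (Finset.mem_univ k)
  have hadm : gappedTwelve.Admissible t :=
    { inj := ht
      norm_lo := fun k => by
        have h := (hnorm (t k) (hmem k)).1
        show ((49 / 50 : ℚ) : ℝ) ≤ ‖t k‖
        norm_num at h ⊢; exact h
      norm_hi := fun k => by
        have h := (hnorm (t k) (hmem k)).2
        show ‖t k‖ ≤ ((51 / 50 : ℚ) : ℝ)
        norm_num at h ⊢; exact h
      dist_lo := fun k l hkl => by
        have h := (hdist (t k) (hmem k) (t l) (hmem l) (ht.ne hkl)).1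
        show ((49 / 50 : ℚ) : ℝ) ≤ dist (t k) (t l)
        norm_num at h ⊢; exact h
      dist_alt := fun k l hkl => by
        have h := (hdist (t k) (hmem k) (t l) (hmem l) (ht.ne hkl)).2
        show dist (t k) (t l) ≤ ((51 / 50 : ℚ) : ℝ) ∨ ((63 / 50 : ℚ) : ℝ) ≤ dist (t k) (t l)
        norm_num at h ⊢; exact h }
  obtain ⟨i, hi, hclose⟩ := Spec.good_of_claim_nil hclaim t hadm
  have heta : ((gappedTwelve.eta : ℚ) : ℝ) = 1 / 5 := by norm_num [gappedTwelve]
  rw [heta] at hclose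
  have hi3 : i < 3 := hi
  interval_cases i
  · left
    have h := shellCloseTo_of_tupleClose ht fccTuple_injective hclose
    rwa [image_fccTuple] at h
  · right; left
    have h := shellCloseTo_of_tupleClose ht hcpTuple_injective hclose
    rwa [image_hcpTuple] at h
  · right; right
    have h := shellCloseTo_of_tupleClose ht decTuple_injective hclose
    rwa [image_decTuple] at h

/-- **Replaying an accepted census certificate proves `ShellCensus`** (kernel path `decide`
for toy certificates; `native_decide` — a `computational` proposal — for the lane's). [folklore] -/
theorem shellCensus_of_check (C : Census) (hC : Census.check gappedTwelve C = true) :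
    ∀ T : Finset (EuclideanSpace ℝ (Fin 3)), T.card = 12 →
      (∀ v ∈ T, 1 - 1 / 50 ≤ ‖v‖ ∧ ‖v‖ ≤ 1 + 1 / 50) →
      (∀ v ∈ T, ∀ w ∈ T, v ≠ w → 1 - 1 / 50 ≤ dist v w ∧ (dist v w ≤ 1 + 1 / 50 ∨ 63 / 50 ≤ dist v w)) →
      Literature.Geometry.DiscreteGeometry.ShellCloseTo (1 / 5) T
          Literature.Geometry.DiscreteGeometry.fccKissingPattern ∨
        Literature.Geometry.DiscreteGeometry.ShellCloseTo (1 / 5) T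
          Literature.Geometry.DiscreteGeometry.hcpKissingPattern ∨
        Literature.Geometry.DiscreteGeometry.ShellCloseTo (1 / 5) T
          ((Finset.univ.image fun k : Fin 5 => !₂[Real.sqrt 3 / 2 * Real.cos (2 * Real.pi * k / 5),
              Real.sqrt 3 / 2 * Real.sin (2 * Real.pi * k / 5), (1 : ℝ) / 2]) ∪
            (Finset.univ.image fun k : Fin 5 => !₂[Real.sqrt 3 / 2 * Real.cos (2 * Real.pi * k / 5),
              Real.sqrt 3 / 2 * Real.sin (2 * Real.pi * k / 5), -(1 : ℝ) / 2]) ∪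
            {!₂[(0 : ℝ), 0, 1], !₂[(0 : ℝ), 0, -1]}) :=
  shellCensus_of_claim (Census.check_sound gappedTwelvePatterns C hC)

/-! ### Non-vacuity: the fcc pattern is itself an admissible configuration -/

/-- Squared distances between distinct points of the fcc pattern, doubled, are `2` (bond) or at
least `4` (`√2`, `√3`, `2` in bond units). [cite: HalesDSP2012, §1.3] -/
theorem sqNormInt_fccVec_sub :
    ∀ j k : Fin 12, j ≠ k → sqNormInt (fccVec j - fccVec k) = 2 ∨ 4 ≤ sqNormInt (fccVec j - fccVec k) := by
  decide

/-- Distances in the fcc tuple: `dist = (√2)⁻¹ · √(sqNormInt (vⱼ − v_k))`. [folklore] -/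
theorem dist_fccTuple (j k : Fin 12) :
    dist (fccTuple j) (fccTuple k) = (Real.sqrt 2)⁻¹ * Real.sqrt (sqNormInt (fccVec j - fccVec k) : ℝ) := by
  rw [fccTuple, fccTuple, dist_eq_norm, ← smul_sub, intVec_sub, norm_smul, norm_inv, norm_intVec,
    Nat.cast_ofNat, Real.norm_of_nonneg (Real.sqrt_nonneg _)]

/-- **The census hypotheses are consistent**: the fcc pattern (unit bonds) is an admissible
twelve-tuple of `gappedTwelve` — norms `1`, distances `1` or `≥ √2 > 63/50`. [cite: HalesDSP2012, §1.3] -/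
theorem admissible_fccTuple : gappedTwelve.Admissible fccTuple where
  inj := fccTuple_injective
  norm_lo k := by
    have hk : fccTuple k ∈ fccKissingPattern := by
      rw [← image_fccTuple]; exact Finset.mem_image_of_mem _ (Finset.mem_univ k)
    rw [norm_eq_one_of_mem_fccKissingPattern hk]
    norm_num [gappedTwelve]
  norm_hi k := by
    have hk : fccTuple k ∈ fccKissingPattern := by
      rw [← image_fccTuple]; exact Finset.mem_image_of_mem _ (Finset.mem_univ k)
    rw [norm_eq_one_of_mem_fccKissingPattern hk]
    norm_num [gappedTwelve]
  dist_lo j k hjk := by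
    have hj : fccTuple j ∈ fccKissingPattern := by
      rw [← image_fccTuple]; exact Finset.mem_image_of_mem _ (Finset.mem_univ j)
    have hk : fccTuple k ∈ fccKissingPattern := by
      rw [← image_fccTuple]; exact Finset.mem_image_of_mem _ (Finset.mem_univ k)
    have h1 := one_le_dist_of_mem_fccKissingPattern hj hk (fccTuple_injective.ne hjk)
    have h : ((gappedTwelve.dlo : ℚ) : ℝ) ≤ 1 := by norm_num [gappedTwelve]
    exact h.trans h1
  dist_alt j k hjk := by
    have h2 : (0 : ℝ) < Real.sqrt 2 := by positivity
    have hs2 : Real.sqrt 2 ^ 2 = 2 := Real.sq_sqrt zero_le_two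
    obtain ⟨hlo, -⟩ := sqrt_two_bounds
    rw [dist_fccTuple]
    rcases sqNormInt_fccVec_sub j k hjk with h | h
    · left
      rw [h, Int.cast_ofNat, inv_mul_cancel₀ h2.ne']
      norm_num [gappedTwelve]
    · right
      have h4 : (4 : ℝ) ≤ (sqNormInt (fccVec j - fccVec k) : ℝ) := by exact_mod_cast h
      have hsq : 2 ≤ Real.sqrt (sqNormInt (fccVec j - fccVec k) : ℝ) := by
        rw [show (2 : ℝ) = Real.sqrt 4 by rw [show (4 : ℝ) = 2 ^ 2 by norm_num, Real.sqrt_sq zero_le_two]]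
        exact Real.sqrt_le_sqrt h4
      have hgap : ((gappedTwelve.gap : ℚ) : ℝ) = 63 / 50 := by norm_num [gappedTwelve]
      rw [hgap]
      calc (63 / 50 : ℝ) ≤ (Real.sqrt 2)⁻¹ * 2 := by
            rw [le_inv_mul_iff₀ h2]; nlinarith
        _ ≤ (Real.sqrt 2)⁻¹ * Real.sqrt (sqNormInt (fccVec j - fccVec k) : ℝ) :=
            mul_le_mul_of_nonneg_left hsq (inv_nonneg.2 h2.le)

/-! ### A toy census, checked in the kernel -/

/-- A toy specification exercising every rule: three unit vectors, pairs within `1/10` or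
at least `3` apart (impossible for unit vectors), one pattern. [folklore] -/
def toySpec : Spec where
  n := 3
  rlo := 1
  rhi := 1
  dlo := 0
  dhi := 1 / 10
  gap := 3
  eta := 3
  eps := 0
  anchors := [[(0, 0, 1), (0, 0, 1), (0, 0, 1)]]

/-- The toy pattern (all three points at the north pole). [folklore] -/
noncomputable def toyPatterns : toySpec.Patterns where
  pts := [fun _ => qpt (0, 0, 1)]
  len_eq := rfl
  close i hi k := by
    have hi1 : i < 1 := hi
    interval_cases i
    have : toySpec.anchor 0 k = (0, 0, 1) := by
      unfold Spec.anchor toySpec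
      have hk := k.2
      simp only [toySpec] at hk
      interval_cases (k : ℕ) <;> rfl
    rw [this]
    simp only [List.getElem_cons_zero, dist_self]
    simp [toySpec]

/-- A toy census: "pair `(0,1)` far" is infeasible (entry 0, by the root-box exclusion test);
the other far pairs follow by relabelling (entries 1, 2); the unconditional entry 3 splits on
all three pairs and accepts the all-bond case at once. [folklore] -/
def toyCensus : Census :=
  [([(0, 1, false)], .frame (.empty (.farLo 0 1))),
   ([(0, 2, false)], .ref [0, 2, 1] 0),
   ([(1, 2, false)], .ref [1, 2, 0] 0),
   ([], .case 0 1
      (.case 0 2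
        (.case 1 2 (.frame (.split 5 0 (.accept 0 [1, 0, 0, 0, 1, 0, 0, 0, 1] [0, 1, 2])
          (.accept 0 [1, 0, 0, 0, 1, 0, 0, 0, 1] [0, 1, 2]))) (.ref [0, 1, 2] 2))
        (.ref [0, 1, 2] 1))
      (.ref [0, 1, 2] 0))]

/-- The toy census is accepted (kernel evaluation of the checker). [folklore] -/
theorem toyCensus_check : Census.check toySpec toyCensus = true := by decide +kernel

/-- End-to-end: the toy census proves its claim. -/
example : toySpec.Claim toyPatterns [] := Census.check_sound toyPatterns toyCensus toyCensus_check

/-- **`ShellCensus` from a text certificate**: the intended entry point for the lane's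
certificate, `shellCensus_of_text "<tokens>" (by native_decide)`. [folklore] -/
theorem shellCensus_of_text (s : String) (h : Census.check gappedTwelve (Census.ofText s) = true) :
    ∀ T : Finset (EuclideanSpace ℝ (Fin 3)), T.card = 12 →
      (∀ v ∈ T, 1 - 1 / 50 ≤ ‖v‖ ∧ ‖v‖ ≤ 1 + 1 / 50) →
      (∀ v ∈ T, ∀ w ∈ T, v ≠ w → 1 - 1 / 50 ≤ dist v w ∧ (dist v w ≤ 1 + 1 / 50 ∨ 63 / 50 ≤ dist v w)) →
      Literature.Geometry.DiscreteGeometry.ShellCloseTo (1 / 5) T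
          Literature.Geometry.DiscreteGeometry.fccKissingPattern ∨
        Literature.Geometry.DiscreteGeometry.ShellCloseTo (1 / 5) T
          Literature.Geometry.DiscreteGeometry.hcpKissingPattern ∨
        Literature.Geometry.DiscreteGeometry.ShellCloseTo (1 / 5) T
          ((Finset.univ.image fun k : Fin 5 => !₂[Real.sqrt 3 / 2 * Real.cos (2 * Real.pi * k / 5),
              Real.sqrt 3 / 2 * Real.sin (2 * Real.pi * k / 5), (1 : ℝ) / 2]) ∪
            (Finset.univ.image fun k : Fin 5 => !₂[Real.sqrt 3 / 2 * Real.cos (2 * Real.pi * k / 5),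
              Real.sqrt 3 / 2 * Real.sin (2 * Real.pi * k / 5), -(1 : ℝ) / 2]) ∪
            {!₂[(0 : ℝ), 0, 1], !₂[(0 : ℝ), 0, -1]}) :=
  shellCensus_of_check (Census.ofText s) h

end ShellCensus

end Literature.Geometry.DiscreteGeometry

end
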